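/-
Origin: expansion seat `planner-pub-hodgecm-pv09-g5-0`, handover #1 2026-08-18T08:59:39Z (`HOME/pub-hodgecm-pv09-g5/lean/Pv09g5/GenuineHeadline.lean`, md5 78c17e18, 320 lines);
landed by the gen-7 packager in gate run 27 as `HodgeCM/PerL34/GenuineHeadline.lean` (import ^import Pv[0-9]+g[0-9]+\.→import HodgeCM.PerL34. ×2).
-/
/-
HodgeCM / PerL34 publication cell — seam S3 (node N31, Lemma 4.2(b)), 𝓕-side: the JUNCTION file
(pub-hodgecm-pv09-g5, DAG-node prover #09 gen 5, HANDOVER #1).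
WIP imports: `Pv09g4.LocSecondCountable` ↦
`HodgeCM.PerL34.LocSecondCountable` (pv09-g4 HANDOVER #18, run 27), `Pv07g3.LocTorusCompact` ↦
`HodgeCM.PerL34.LocTorusCompact` (pv07-g3, run 27).  Complete proofs, no new axioms, nothing cited.
-/
import Summits.HodgeConjecture.HodgeCM.PerL34.GenuineSetUp
import Summits.HodgeConjecture.HodgeCM.PerL34.LocSecondCountable
import Summits.HodgeConjecture.HodgeCM.PerL34.LocTorusCompact_2

/-!
# The S3 headline for the GENUINE unitary torus `U(1)_{L/L⁺}(𝔸_{L⁺}) ⊇ U(1)(L⁺)`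

pv09-g4's `PureTensor.exists_compactDomain_thetaLift_ne_zero_of_model` (file `ModelTransport`) is the S3
headline (`∃` a compact fundamental domain `𝓕` with non-empty interior for `Γ = jA(U(L))` in the restricted
product `A = Πʳ_v (G_v : B_v)`, of positive finite Haar measure, on which the theta-lift pairing is `≠ 0`)
over an ABSTRACT family of local groups `G_v ⊇ B_v` plus a model isomorphism
`e : A ≃ₜ* U(1)_{L₁/K₁}(𝔸_{K₁})`.  Its place data — the local groups, the levels, their compactness /
openness, countability of the index set, the discrete-cocompact set-up, the split/non-split dichotomy
`IsSplit`, the places `w v` of the coefficient field, the identifications `τ_v : G_v ≃ₜ* L_{w v}ˣ` at the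
split places, `ord_v`, the uniformizers `ϖ_v`, `ϖ^F_v` and the five facts `hw hBi hϖF ord_ϖ ker_ord hcpt`
relating them — were BINDERS.

This file instantiates ALL of them at the genuine torus of a CM field `L` over `L⁺ := maximalRealSubfield L`:

* `ι := Place L⁺`, `G_v := locTorus L⁺ L v = U(1)_{L/L⁺}(L⁺_v)` (pv09-g4 `IdelicTorusModel`), levels
  `B_v := (Π_{w ∣ v} 𝒪_wˣ) ⊓ G_v` (`Genuine.genLevel`), `A = GenuineSetUp.Model L`, `jA := unitaryToModel L`,
  `e := (torusEquiv L⁺ L).symm`, `K₁ := L⁺`, `L₁ := L`, and the coefficient field `L₀ := L` itself;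
* `Genuine.placeOver v` — a place of `L` over the finite place `v` of `L⁺` (vendored `under_surjective`);
  `Genuine.IsSplitPlace v :↔ v` is finite and `c • placeOver v ≠ placeOver v` (`c` = complex conjugation;
  at a non-split finite `v` the fibre is the single `c`-fixed place `placeOver v`, pv07-g3 `fib_eq_of_fixed`);
* `Genuine.splitTriv v hs : G_v ≃ₜ* L_{placeOver v}ˣ` := pv07-g3 `splitEquiv` (first coordinate);
  `Genuine.unifF w` a uniformizer of `L_w` (pv07-g2 `Adic.exists_isUniformizer`); `Genuine.ord v`,
  `Genuine.unif v` := pv07-g3 `splitOrd` / `splitUnif` at split `v`, trivial elsewhere;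
* the facts: `hBc` = pv07-g3 `isCompact_inH_inr` + (infinite `v`) `inH_inl_eq_top` & `U(1)_v` compact;
  `hBo` = `isOpen_inH_pl`; `hBi` = `inH_inl_eq_top` / `inH_eq_top_inr_of_isCMField`; `hcpt` =
  `compactSpace_locTorus_inl_of_isCMField'` / `compactSpace_locTorus_inr_of_isCMField`; `ord_ϖ`, `ker_ord` =
  `splitOrd_splitUnif`, `splitOrd_eq_one_iff`; `hw` = `placeOver_under`; the instances
  `[Countable (Place L⁺)]` (pv07-g3), `[SecondCountableTopology / LocallyCompactSpace / T2Space /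
  MeasurableSpace / BorelSpace (G_v)]` (pv09-g4 `LocTorusClosed`, `LocSecondCountable`),
  `[DiscreteTopology Γ] [CompactSpace (A ⧸ Γ)]` (pv11-g4's `L¹` discrete & cocompact, transported by pv09-g4
  `DiscreteFD.instances_of_modelEquiv` inside `…_of_model`; cf. `GenuineSetUp.setUp_instances`).

**Result** `PureTensor.exists_compactDomain_thetaLift_ne_zero_genuine`: the S3 headline for `U(1)_{L/L⁺}`
whose ONLY remaining hypotheses are representation-side (the doubling / theta data `D`, `GU`, the line
`(W,h)`, `j`, the character `χ`, the vector `φ` and their local properties `hloc hχT' hlocχ hK hM`, the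
local coefficient identities `coeff_eq` / `coeffS` against the dilation model at the split places, `hν hνS
hχS hr hr0 hcS`, and `hiso` at the non-split places of `S`), plus the bookkeeping hypothesis
`hS : every infinite place of L⁺ lies in S`, the σ-algebra binders `[MeasurableSpace (L_w)] [BorelSpace (L_w)]`
(inhabited by `borel _`, `⟨rfl⟩` — tree `Adic.borel_exists`) and `[DecidableEq (Place L⁺)]` (any instance).

Nothing is cited; PerL v5 ll. 600–640 (proof of Lemma 4.2(b)) is the USE of this statement.
-/

set_option autoImplicit false

noncomputable section

open MeasureTheory MeasureTheory.Measure Set Metric Function Complex ComplexConjugate Topology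
open scoped RestrictedProduct InnerProductSpace NNReal ENNReal

/-! ## §1  Place data of the genuine torus of a CM field -/

namespace HodgeCM.PerL34.IdelicTorusModel

namespace Genuine

open IdelePlaces RestrictedRegroup RestrictedCutout NumberField IsDedekindDomain Sum
open HodgeCM.PerL34.LocalFactors.DilationModel

attribute [local instance] LocalFactors.DilationModel.Adic.nontriviallyNormedField
  LocalFactors.DilationModel.Adic.properSpace

variable (L : Type) [Field L] [NumberField L] [IsCMField L]

local notation3 "L⁺" => maximalRealSubfield L

omit [IsCMField L] in
/-- A number field has a finite place (a maximal ideal of `𝓞 L` is a non-zero prime). -/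
theorem nonempty_heightOneSpectrum : Nonempty (HeightOneSpectrum (𝓞 L)) := by
  obtain ⟨P, hP⟩ := Ideal.exists_maximal (𝓞 L)
  exact ⟨⟨P, hP.isPrime, Ring.ne_bot_of_isMaximal_of_not_isField hP (RingOfIntegers.not_isField L)⟩⟩

omit [IsCMField L] in
/-- Every finite place `v` of `L⁺` lies under a finite place of `L`. -/
theorem exists_under_eq (v : HeightOneSpectrum (𝓞 L⁺)) : ∃ w : HeightOneSpectrum (𝓞 L), w.under (𝓞 L⁺) = v :=
  Literature.NumberTheory.Automorphic.HeightOneSpectrum.under_surjective v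

/-- `placeOver v`: a chosen place of `L` over the finite place `v` of `L⁺`. -/
def placeOver (v : HeightOneSpectrum (𝓞 L⁺)) : HeightOneSpectrum (𝓞 L) := (exists_under_eq L v).choose

omit [IsCMField L] in
/-- (Ported verbatim from the HodgeCMPerL package; no docstring in the source.) -/
theorem placeOver_under (v : HeightOneSpectrum (𝓞 L⁺)) : (placeOver L v).under (𝓞 L⁺) = v :=
  (exists_under_eq L v).choose_spec

/-- **The split/non-split dichotomy.**  A place of `L⁺` *splits* if it is finite and complex conjugation moves
the chosen place over it (equivalently: moves some / every place of `L` over it — at a `c`-fixed `w` the fibre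
is `{w}`, pv07-g3 `fib_eq_of_fixed`).  Infinite places never split (`c • w = w`, `L` is CM). -/
def IsSplitPlace : Place L⁺ → Prop
  | inl _ => False
  | inr v => IsCMField.complexConj L • placeOver L v ≠ placeOver L v

/-- `placeOf i`: the place of the coefficient field `L₀ := L` attached to the index `i` (the END's `w i`):
`placeOver v` at a finite `v`, an arbitrary finite place at an infinite one (never used there). -/
def placeOf : Place L⁺ → HeightOneSpectrum (𝓞 L)
  | inl _ => (nonempty_heightOneSpectrum L).some
  | inr v => placeOver L v

omit [IsCMField L] in
/-- END binder `hw`: `placeOf` is injective on the finite places (hence on the complement of any `S`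
containing the infinite ones). -/
theorem placeOf_injOn {S : Finset (Place L⁺)} (hS : ∀ v : InfinitePlace L⁺, inl v ∈ S) :
    ∀ ⦃i j : Place L⁺⦄, i ∉ S → j ∉ S → placeOf L i = placeOf L j → i = j := by
  rintro (x | v) (y | v') hi hj h
  · exact absurd (hS x) hi
  · exact absurd (hS x) hi
  · exact absurd (hS y) hj
  · change placeOver L v = placeOver L v' at h
    rw [← placeOver_under L v, ← placeOver_under L v', h]

/-- **The levels** `B_v := (Π_{w ∣ v} 𝒪_wˣ) ⊓ U(1)_v` of the genuine model (the `B` of `GenuineSetUp.Model`). -/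
abbrev genLevel : ∀ k : Place L⁺, Subgroup (locTorus L⁺ L k) :=
  fun k => inH (fun k => fibSubgroup (intUnits L) (pl L⁺ L) k) (locTorus L⁺ L) k

/-- END binder `hcpt` (all places, not only `S`): `U(1)_v` is compact at every non-split place. -/
theorem compactSpace_of_not_isSplitPlace : ∀ i : Place L⁺, ¬IsSplitPlace L i → CompactSpace (locTorus L⁺ L i)
  | inl v, _ => compactSpace_locTorus_inl_of_isCMField' L v
  | inr v, hs => compactSpace_locTorus_inr_of_isCMField L (placeOver_under L v) (not_not.1 hs)

/-- END binder `hBi` (all places): at a non-split place the level is all of `U(1)_v`. -/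
theorem genLevel_eq_top_of_not_isSplitPlace : ∀ i : Place L⁺, ¬IsSplitPlace L i → genLevel L i = ⊤
  | inl v, _ => inH_inl_eq_top L⁺ L v
  | inr v, hs => inH_eq_top_inr_of_isCMField L (placeOver_under L v) (not_not.1 hs)

/-- (Ported verbatim from the HodgeCMPerL package; no docstring in the source.) -/
theorem coe_genLevel_eq_univ (i : Place L⁺) (hs : ¬IsSplitPlace L i) : (genLevel L i : Set (locTorus L⁺ L i)) = univ := by
  rw [genLevel_eq_top_of_not_isSplitPlace L i hs, Subgroup.coe_top]

/-- END binder `hBc`: every level is compact. -/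
theorem isCompact_genLevel : ∀ i : Place L⁺, IsCompact (genLevel L i : Set (locTorus L⁺ L i))
  | inl v => by
    haveI := compactSpace_locTorus_inl_of_isCMField' L v
    rw [coe_genLevel_eq_univ L (inl v) not_false]
    exact isCompact_univ
  | inr v => isCompact_inH_inr L⁺ L v

omit [IsCMField L] in
/-- END binder `hBo`: every level is open. -/
theorem isOpen_genLevel (i : Place L⁺) : IsOpen (genLevel L i : Set (locTorus L⁺ L i)) := isOpen_inH_pl L⁺ L i

/-- END binder `τ`: at a split place, `U(1)_v ≃ₜ* L_{placeOver v}ˣ` (first coordinate; pv07-g3 `splitEquiv`). -/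
def splitTriv : ∀ i : Place L⁺, IsSplitPlace L i → (locTorus L⁺ L i ≃ₜ* ((placeOf L i).adicCompletion L)ˣ)
  | inl _, hs => hs.elim
  | inr v, hs => splitEquiv (IsCMField.complexConj L) (placeOver_under L v) (eq_one_or_eq_complexConj L) hs

omit [IsCMField L] in
/-- a uniformizer `ϖ^F_w` of `L_w` exists at every finite place (pv07-g2) -/
theorem exists_isUniformizer (w : HeightOneSpectrum (𝓞 L)) : ∃ ϖ : (w.adicCompletion L)ˣ, IsUniformizer ϖ :=
  Adic.exists_isUniformizer L w

/-- END binder `ϖF`: a chosen uniformizer of `L_w`. -/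
def unifF (w : HeightOneSpectrum (𝓞 L)) : (w.adicCompletion L)ˣ := (exists_isUniformizer L w).choose

omit [IsCMField L] in
/-- END binder `hϖF` (at every index). -/
theorem isUniformizer_unifF (w : HeightOneSpectrum (𝓞 L)) : IsUniformizer (unifF L w) :=
  (exists_isUniformizer L w).choose_spec

open Classical in
/-- END binder `ord`: `ord_v := ord_{ϖ^F} ∘ splitTriv` at a split place, trivial elsewhere. -/
def ord : ∀ i : Place L⁺, locTorus L⁺ L i →* Multiplicative ℤ
  | inl _ => 1
  | inr v =>
    if hs : IsSplitPlace L (inr v) then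
      splitOrd (IsCMField.complexConj L) (placeOver_under L v) (eq_one_or_eq_complexConj L) hs
        (isUniformizer_unifF L (placeOver L v))
    else 1

open Classical in
/-- END binder `ϖ`: `ϖ_v := splitTriv⁻¹ (ϖ^F_{placeOver v})` at a split place, `1` elsewhere. -/
def unif : ∀ i : Place L⁺, locTorus L⁺ L i
  | inl _ => 1
  | inr v =>
    if hs : IsSplitPlace L (inr v) then
      splitUnif (IsCMField.complexConj L) (placeOver_under L v) (eq_one_or_eq_complexConj L) hs
        (unifF L (placeOver L v))
    else 1

/-- END binder `ord_ϖ`: `ord_v ϖ_v = 1 ∈ ℤ` at a split place. -/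
theorem ord_unif : ∀ i : Place L⁺, IsSplitPlace L i → ord L i (unif L i) = Multiplicative.ofAdd 1
  | inl _, hs => hs.elim
  | inr v, hs => by
    simp only [ord, unif, dif_pos hs]
    exact splitOrd_splitUnif (IsCMField.complexConj L) (placeOver_under L v) (eq_one_or_eq_complexConj L) hs
      (isUniformizer_unifF L (placeOver L v))

/-- END binder `ker_ord`: `ord_v g = 1 ↔ g ∈ B_v` at a split place. -/
theorem ord_eq_one_iff : ∀ i : Place L⁺, IsSplitPlace L i → ∀ g : locTorus L⁺ L i, ord L i g = 1 ↔ g ∈ genLevel L i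
  | inl _, hs => hs.elim
  | inr v, hs => fun g => by
    simp only [ord, dif_pos hs]
    exact splitOrd_eq_one_iff (IsCMField.complexConj L) (placeOver_under L v) (eq_one_or_eq_complexConj L) hs
      (isUniformizer_unifF L (placeOver L v)) g

/-- at a split place `splitTriv` carries the genLevel onto `𝒪_wˣ` (pv07-g3 `mem_inH_iff_of_split`; recorded for
consumers stating `hχS` / `coeffS`). -/
theorem mem_genLevel_iff_splitTriv_mem (v : HeightOneSpectrum (𝓞 L⁺)) (hs : IsSplitPlace L (inr v))
    (g : locTorus L⁺ L (inr v)) : g ∈ genLevel L (inr v) ↔ splitTriv L (inr v) hs g ∈ intUnits L (inr (placeOver L v)) :=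
  mem_inH_iff_of_split (IsCMField.complexConj L) (placeOver_under L v) (eq_one_or_eq_complexConj L) hs g

end Genuine

end HodgeCM.PerL34.IdelicTorusModel

/-! ## §2  The headline for `U(1)_{L/L⁺}` -/

namespace HodgeCM.PerL34.PureTensor

open HodgeCM.PerL34.SplitShells HodgeCM.PerL34.AdelicFactorisation HodgeCM.PerL34.RestrictedMeasure
open HodgeCM.PerL34.NoSmallSubgroups HodgeCM.PerL34.EulerFactorisation HodgeCM.PerL34.DiscreteFD
open HodgeCM.PerL34.LocalFactors HodgeCM.PerL34.LocalFactors.DilationModel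
open HodgeCM.PerL34.LocalModulus HodgeCM.PerL34.SplitPlaceDilation
open HodgeCM.PerL34.RallisIP HodgeCM.PerL34.Doubling HodgeCM.PerL34.N31d NumberField IsDedekindDomain
open HodgeCM.PerL34.IdelePlaces HodgeCM.PerL34.RestrictedRegroup HodgeCM.PerL34.RestrictedCutout
open HodgeCM.PerL34.IdelicTorusModel HodgeCM.PerL34.IdelicTorusModel.Genuine

attribute [local instance] LocalFactors.DilationModel.Adic.nontriviallyNormedField
  LocalFactors.DilationModel.Adic.properSpace

section genuine

variable (L : Type) [Field L] [NumberField L] [IsCMField L]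

-- (no `L⁺` notation in this section: a `notation3` token inside `variable` binders does not re-elaborate)

variable [DecidableEq (Place (maximalRealSubfield L))]
  [∀ w : HeightOneSpectrum (𝓞 L), MeasurableSpace (w.adicCompletion L)]
  [∀ w : HeightOneSpectrum (𝓞 L), BorelSpace (w.adicCompletion L)]
  (S₀ : Finset (Place (maximalRealSubfield L)))
  {Sp : Type} [NormedAddCommGroup Sp] [InnerProductSpace ℂ Sp]
  {E : Type*} [NormedAddCommGroup E] [InnerProductSpace ℂ E]
  {W : Type} [AddCommGroup W] [Module L W]
  {H Sbox : Type} [Group H] [AddCommGroup Sbox] [Module ℂ Sbox]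
  {h : W →ₗ⋆[L] W →ₗ[L] L} (hW : IsLine L W) (hh : Anisotropic h)
  (D : DoublingDatum (Model L) H Sp Sbox) (GU : ThetaSide Sp Sbox)
  (j : isomBox h →* H) (hj : ∀ d : unitary L, j ⟨iotaSnd d, iotaSnd_mem h d⟩ = D.ι (1, unitaryToModel L d))
  (χ : Model L →* Circle) (hχΓ : ∀ d : unitary L, χ (unitaryToModel L d) = 1)
  (hχVΓ : ∀ d : unitary L, D.χV (unitaryToModel L d) = 1)
  {hP : ∀ Ψ : Sbox, ∀ p ∈ (stabDelta L W).subgroupOf (isomBox h), ∀ x : H,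
    D.fSW Ψ (j p * x) = D.fSW Ψ x}
  (P : GluePrintInputs D GU h j hP) (φ : Sp)
  (hφ : ‖φ‖ = 1)
  (hloc : ∀ (i : Place (maximalRealSubfield L)) (v : Sp),
    Continuous fun g : locTorus (maximalRealSubfield L) L i => D.ω (RestrictedProduct.mulSingle (genLevel L) i g) v)
  {T' : Finset (Place (maximalRealSubfield L))} (hχT' : RestrictedProduct.boxSubgroup (genLevel L) T' ≤ χ.ker)
  (hlocχ : ∀ i ∈ T', Continuous fun g : locTorus (maximalRealSubfield L) L i => χ (RestrictedProduct.mulSingle (genLevel L) i g))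
  {T : Finset (Place (maximalRealSubfield L))} (hK : ∀ k ∈ RestrictedProduct.boxSubgroup (genLevel L) T, D.ω k φ = φ)
  (hM : ∀ S : Finset (Place (maximalRealSubfield L)), T ⊆ S → ∀ y : (i : ↥S) → locTorus (maximalRealSubfield L) L i,
    inner ℂ φ (D.ω (extendOne (genLevel L) S y) φ) = ∏ i : ↥S, localCoeff (genLevel L) D.ω φ i (y i))
  {S : Finset (Place (maximalRealSubfield L))} (hTS : T ⊆ S) (hT'S : T' ⊆ S)
  -- bookkeeping: `S` contains the infinite places
  (hS : ∀ v : InfinitePlace (maximalRealSubfield L), Sum.inl v ∈ S)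
  -- the local characters `ν_v` of `L_{w v}ˣ` of the dilation model and their properties
  (ν : ∀ i : Place (maximalRealSubfield L), ((placeOf L i).adicCompletion L)ˣ →* Circle)
  (hν : ∀ i, i ∉ S → IsSplitPlace L i → ∀ u : ((placeOf L i).adicCompletion L)ˣ,
    ‖(u : (placeOf L i).adicCompletion L)‖ = 1 → ν i u = 1)
  (coeff_eq : ∀ i, i ∉ S → IsSplitPlace L i → ∀ n : ℤ, localCoeff (genLevel L) D.ω φ i (unif L i ^ n)
    = ⟪ballIndicator (Adic.muV L (placeOf L i)) 0 1,
        dilationRep (Adic.muV L (placeOf L i)) (ν i) (unifF L (placeOf L i) ^ n)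
          (ballIndicator (Adic.muV L (placeOf L i)) 0 1)⟫_ℂ)
  (x₀ : ∀ i : Place (maximalRealSubfield L), Fin 3 → (placeOf L i).adicCompletion L) (r cS : Place (maximalRealSubfield L) → ℝ)
  (hr : ∀ i ∈ S, IsSplitPlace L i → r i < ‖x₀ i‖) (hr0 : ∀ i ∈ S, IsSplitPlace L i → 0 < r i)
  (hcS : ∀ i ∈ S, IsSplitPlace L i → 0 < cS i)
  (hνS : ∀ i ∈ S, IsSplitPlace L i → ∀ y : ((placeOf L i).adicCompletion L)ˣ,
    (y : (placeOf L i).adicCompletion L) ∈ U1 (x₀ i) (r i) → ν i y = 1)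
  (hχS : ∀ i (_ : i ∈ S) (hs : IsSplitPlace L i), ∀ g : locTorus (maximalRealSubfield L) L i,
    ((splitTriv L i hs g : ((placeOf L i).adicCompletion L)ˣ) : (placeOf L i).adicCompletion L) ∈ U1 (x₀ i) (r i) →
      χ (RestrictedProduct.mulSingle (genLevel L) i g) = 1)
  (coeffS : ∀ i (_ : i ∈ S) (hs : IsSplitPlace L i), ∀ g : locTorus (maximalRealSubfield L) L i, localCoeff (genLevel L) D.ω φ i g
    = (cS i : ℂ) * ⟪ballIndicator (Adic.muV L (placeOf L i)) (x₀ i) (r i),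
        dilationRep (Adic.muV L (placeOf L i)) (ν i) (splitTriv L i hs g)
          (ballIndicator (Adic.muV L (placeOf L i)) (x₀ i) (r i))⟫_ℂ)
  (hiso : ∀ i ∈ S, ¬IsSplitPlace L i → ∀ g : locTorus (maximalRealSubfield L) L i, D.ω (RestrictedProduct.mulSingle (genLevel L) i g) φ
    = conj (((χ (RestrictedProduct.mulSingle (genLevel L) i g) : Circle) : ℂ)) • φ)

include hW hh hj hχΓ hχVΓ P hφ hloc hK hM hTS hT'S hS hν coeff_eq hr hr0 hcS hνS hχS coeffS hiso

set_option synthInstance.maxHeartbeats 200000 in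
-- (the `SMul Γ (Model L)` instance behind `IsFundamentalDomain` is found through the restricted-product `SMul`
-- instances only slowly at these concrete types — budget as in tree `Model/Toy/Weil`, `Model/ToyG2/EllType`)
/-- **S3 HEADLINE for the genuine unitary torus `U(1)_{L/L⁺}(𝔸_{L⁺}) ⊇ U(1)(L⁺)` of a CM field `L`.**
pv09-g4's `exists_compactDomain_thetaLift_ne_zero_of_model` with every place-data binder (`G B hBc hBo jA e he
he' IsSplit L₀ w hw hBi ord ϖ ϖF hϖF ord_ϖ ker_ord τ hcpt` and the instances) DISCHARGED by §1, pv07-g3's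
`LocTorusSplit` / `LocTorusCompact` and pv09-g4's `GenuineSetUp` / `LocTorusClosed` / `LocSecondCountable`:
there is a compact fundamental domain `𝓕 ⊂ U(1)(𝔸_{L⁺})` for `U(1)(L⁺) = jA(U(L))` with non-empty interior and
positive finite Haar measure such that the theta-lift Petersson pairing over `𝓕` against `χ` is `≠ 0`. -/
theorem exists_compactDomain_thetaLift_ne_zero_genuine [IsFiniteMeasure GU.μ] :
    ∃ 𝓕 : Set (Model L), IsCompact 𝓕 ∧ (interior 𝓕).Nonempty ∧ MeasurableSet 𝓕 ∧
      IsFundamentalDomain (unitaryToModel L).range 𝓕 (haarDatum (genLevel L) (isCompact_genLevel L) (isOpen_genLevel L) S₀).μ ∧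
      (haarDatum (genLevel L) (isCompact_genLevel L) (isOpen_genLevel L) S₀).μ 𝓕 ≠ 0 ∧
      (haarDatum (genLevel L) (isCompact_genLevel L) (isOpen_genLevel L) S₀).μ 𝓕 ≠ ⊤ ∧
      ∀ [IsFiniteMeasure (((haarDatum (genLevel L) (isCompact_genLevel L) (isOpen_genLevel L) S₀).μ).restrict 𝓕)]
        (hk : Measurable (Function.uncurry (thetaFn D GU φ))) {Ck : ℝ} (hCk : 0 ≤ Ck)
        (hkC : ∀ q u, ‖thetaFn D GU φ q u‖ ≤ Ck),
        PeterssonFubini.theta GU.μ (((haarDatum (genLevel L) (isCompact_genLevel L) (isOpen_genLevel L) S₀).μ).restrict 𝓕) hk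
          (measurable_coe_char (genLevel L) (isOpen_genLevel L) χ hχT' hlocχ) hCk hkC (norm_coe_char_le χ) ≠ 0 :=
  exists_compactDomain_thetaLift_ne_zero_of_model (genLevel L) (isCompact_genLevel L) (isOpen_genLevel L) S₀ hW hh D GU
    (maximalRealSubfield L) L (unitaryToModel L) (unitaryToModel_injective L) (torusEquiv (maximalRealSubfield L) L).symm
    (torusEquiv_symm_unitaryToModel_mem L) (fun _ ha => torusEquiv_mem_range_unitaryToModel L ha) j hj χ hχΓ
    hχVΓ P φ hφ hloc hχT' hlocχ hK hM hTS hT'S L (placeOf L) (placeOf_injOn L hS) ν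
    (fun i _ hs => coe_genLevel_eq_univ L i hs) (Genuine.ord L) (unif L) (fun i => unifF L (placeOf L i))
    (fun i _ => isUniformizer_unifF L (placeOf L i)) (fun i _ hs => ord_unif L i hs)
    (fun i _ hs => ord_eq_one_iff L i hs) hν coeff_eq (fun i _ hs => splitTriv L i hs) x₀ r cS hr hr0 hcS hνS
    hχS coeffS (fun i _ hs => compactSpace_of_not_isSplitPlace L i hs) hiso

end genuine

end HodgeCM.PerL34.PureTensor

end
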